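import Mathlib
import Literature.NumberTheory.LFunctions.Zhang2022.Section17Phi3plusLine
import Literature.NumberTheory.LFunctions.Zhang2022.PrimitiveCharOrthogonality
import HarnessLib

/-!
# Zhang (2022) §17 p. 96, `Z22:§17.u005` in the derivable (`n ≤ D⁴`) reading: `Φ₃⁺(p)` integrated
# term by term with the error explicit; the diagonal, `#Σ*_{ψ (mod p)} = p − 2`, and the off-diagonal

Topic `Literature/NumberTheory/LFunctions/Zhang2022` (Landau–Siegel audit tree; verdict-neutral).
Y. Zhang, *Discrete mean estimates and the Landau–Siegel zero*, arXiv:2211.02515v1 (2022)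
[Zhang2022LandauSiegel] — **an unrefereed manuscript under adjudication** (cell siegel-zhang, D-0069).
§17 p. 96 [tex L4722–4728]: "Thus, replacing the segment `𝔍(1)` by the line `σ = 3/2` and integrating
term by term give `Φ₃⁺(p) = Σ_mΣ_{n<D⁴} (ν*(m)ν(n)/n)(n/m)^{s₀}(Σ*_{ψ (mod p)}ψ(m)ψ̄(n))exp{−𝓛₂²log²(n/m)}
+ O(ε)` (`Z22:§17.u005`). By trivial estimation, the contribution from the terms with `m ≠ n` above is
`o(p)`. Hence (17.3)." Objects: L4-t6's `Phi3plus`, `chrMod`, `nuStar`, `term_u005`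
(`TypedSection17.lean`). Companion of `Section17Phi3plusLine.lean` (the per-character step).
PROVED here (UNCONDITIONAL — every modulus `D ≥ 2`, 0 new facts):

* `norm_Phi3plus_sub_tsum_le` — **`Z22:§17.u005` with `n ≤ D⁴`** (the range that
  `F(1−s,ψ̄) = Skeleton.FpolyBar` literally has; the typed `Step17_u005` prints `n < D⁴`) and the error
  EXPLICIT instead of `O(ε)`:
  `‖Φ₃⁺(p) − Σ_mΣ_{1≤n≤D⁴} term_u005(p,m,n)‖ ≤ #chrMod(D,p)·(Σ_m|ν*(m)|m^{−3/2})·(Σ_{n≤D⁴}|ν(n)|√n)·e^{(1−𝓛₁²)/(4𝓛₂²)}`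
  (at `𝓛₁ = 𝓛⁴⁰⁵`, `𝓛₂ = 𝓛⁴⁰⁰` the last factor is `e^{1/(4𝓛⁸⁰⁰)}·e^{−𝓛¹⁰/4}`);
* `term_u005_eq` — the dictionary `term_u005(p,m,n) = ν*(m)m^{−s₀}·ν(n)n^{s₀−1}·e^{−𝓛₂²log²(n/m)}·X_p(m,n)`,
  `X_p(m,n) = Σ_{x∈chrMod D p}ψ_x(m)ψ̄_x(n)`, so `Zhang2022/SmoothWeightDiagonal.lean` applies verbatim;
  `summable_sum_term_u005` ((i): the `m`-series of `Σ_n term_u005` is summable); `term_u005_diag` ((ii):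
  the diagonal term `= #chrMod(D,p)·ν*(n)ν(n)/n` for `1 ≤ n < p`); `card_chrMod` (`#chrMod(D,p) = p − 2`
  for `p ∼ P`); `norm_offDiagonal_term_u005_le` ("the terms with `m ≠ n`":
  `≤ (Σ_m|ν*(m)|m^{−3/2})(Σ_{n∈S}|ν(n)|√n)(e^{1/(4𝓛₂²)} + (p−1)e^{−u₀(𝓛₂²u₀−1)})`, `u₀ = log(p/D⁴)`, when
  `D⁴ < p`, `𝓛₂²u₀ ≥ 1`).

What remains for (17.3) as printed is only the SIZE bookkeeping `Σ_m|ν*(m)|m^{−3/2} ≪ 1`,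
`Σ_{n≤D⁴}|ν(n)|√n ≪ D^{O(1)}` (divisor-type bounds) — not asserted here. Nothing in this file bears
on Theorems 1–2 of the source or on the cell's verdict.

## References

* Y. Zhang, arXiv:2211.02515v1 (2022), §17 p. 96 (before (17.3)), (17.3); §2 p. 4 (the family `Ψ`).
  [cite: Zhang2022LandauSiegel, §17 p. 96; §17 (17.3)]
-/
noncomputable section

open Complex Real ComplexConjugate

namespace Literature.NumberTheory.LFunctions.Zhang2022.Phi3TermByTerm

open Literature.NumberTheory.LFunctions.Zhang2022
open Literature.NumberTheory.LFunctions.Zhang2022.Skeleton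
open Literature.NumberTheory.LFunctions.Zhang2022.Typed.Section17
open scoped LSeries.notation

variable (c' : ℝ) {D : ℕ} [NeZero D] (χ : DirichletCharacter ℂ D)

/-! ## The dictionary with t6's `term_u005` and the assembly over `Σ*_{ψ (mod p)}` -/

omit [NeZero D] in
/-- Termwise algebra: `(a(m)m^{−s})(b(n)n^{s−1}) = a(m)b(n)n⁻¹(n/m)^s` (`m, n ≥ 1`). [folklore] -/
private theorem term_mul_eq' (a b : ℕ → ℂ) (s : ℂ) {m n : ℕ} (hm : m ≠ 0) (hn : n ≠ 0) :
    LSeries.term a s m * (b n * (n : ℂ) ^ (s - 1))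
      = a m * b n / (n : ℂ) * (((n : ℝ) / m : ℝ) : ℂ) ^ s := by
  have hm' : (0 : ℝ) < m := Nat.cast_pos.mpr (Nat.pos_of_ne_zero hm)
  have hn' : (0 : ℝ) < n := Nat.cast_pos.mpr (Nat.pos_of_ne_zero hn)
  have hmc : (m : ℂ) ^ s ≠ 0 := fun h => (Nat.cast_ne_zero.mpr hm) ((cpow_eq_zero_iff _ _).mp h).1
  have hnc : (n : ℂ) ≠ 0 := Nat.cast_ne_zero.mpr hn
  rw [LSeries.term_of_ne_zero hm, GaussWeight.div_cpow_line hn' hm', Complex.ofReal_natCast,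
    Complex.ofReal_natCast, Complex.cpow_sub _ _ hnc, Complex.cpow_one]
  field_simp

omit [NeZero D] in
/-- **The dictionary**: t6's `term_u005(p,m,n) = ν*(m)ν(n)/n·(n/m)^{s₀}·X_p(m,n)·e^{−𝓛₂²log²(n/m)}`,
`X_p(m,n) = Σ_{x∈chrMod D p}ψ_x(m)ψ̄_x(n)`, is `term ν* s₀ m · (ν(n)n^{s₀−1}) · e^{−𝓛₂²log²(n/m)} · X_p(m,n)`
— the shape of `Zhang2022/SmoothWeightDiagonal.lean` with `a = ν*`, `b = ν`, `X = X_p` (`n ≥ 1`; for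
`m = 0` both sides vanish). [cite: Zhang2022LandauSiegel, §17 p. 96] -/
theorem term_u005_eq (p m : ℕ) {n : ℕ} (hn : n ≠ 0) :
    term_u005 c' χ p m n
      = LSeries.term (nuStar c' χ) (SmoothWeight.s0 (t0 D)) m *
          (nu χ n * (n : ℂ) ^ (SmoothWeight.s0 (t0 D) - 1)) *
          cexp (-(ell2 D : ℂ) ^ 2 * (Real.log ((n : ℝ) / m) : ℂ) ^ 2) *
          (∑ x ∈ chrMod D p, x.ψ (m : ZMod x.p) * conj (x.ψ (n : ZMod x.p))) := by
  rcases eq_or_ne m 0 with rfl | hm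
  · simp [term_u005, nuStar_zero, LSeries.term_zero]
  rw [term_u005, term_mul_eq' _ _ _ hm hn, Complex.ofReal_exp]
  have e : s0 D = SmoothWeight.s0 (t0 D) := rfl
  rw [e]
  push_cast
  ring

omit [NeZero D] in
/-- The sum over `Σ*_{ψ (mod p)}` of the per-character double-sum terms is `term_u005(p,m,n)` (`n ≥ 1`).
[cite: Zhang2022LandauSiegel, §17 p. 96] -/
theorem sum_chrMod_T_eq_term_u005 (p m : ℕ) {n : ℕ} (hn : n ≠ 0) :
    ∑ x ∈ chrMod D p, LSeries.term (fun m => nuStar c' χ m * psiFn x m) (SmoothWeight.s0 (t0 D)) m *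
        ((nu χ n * conj (x.ψ (n : ZMod x.p))) * (n : ℂ) ^ (SmoothWeight.s0 (t0 D) - 1)) *
        cexp (-(ell2 D : ℂ) ^ 2 * (Real.log ((n : ℝ) / m) : ℂ) ^ 2)
      = term_u005 c' χ p m n := by
  rw [term_u005_eq c' χ p m hn, Finset.mul_sum]
  refine Finset.sum_congr rfl fun x _ => ?_
  rcases eq_or_ne m 0 with rfl | hm
  · simp [LSeries.term_zero]
  rw [LSeries.term_of_ne_zero hm, LSeries.term_of_ne_zero hm, psiFn]
  ring

omit [NeZero D] in
/-- **Summability (i)**: the `m`-series `m ↦ Σ_{n∈S} term_u005(p,m,n)` is summable for any `S ∌ 0`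
(`D ≥ 2`). [cite: Zhang2022LandauSiegel, §17 p. 96] -/
theorem summable_sum_term_u005 (hD : 2 ≤ D) (p : ℕ) {S : Finset ℕ} (hS : 0 ∉ S) :
    Summable fun m : ℕ => ∑ n ∈ S, term_u005 c' χ p m n := by
  have hL : 0 < ell2 D := pow_pos (Real.log_pos (by exact_mod_cast hD)) _
  have ha : LSeriesSummable (nuStar c' χ) (3 / 2 : ℂ) := LSeriesSummable_nuStar c' χ (by norm_num)
  have hX : ∀ m n : ℕ, ‖∑ x ∈ chrMod D p, x.ψ (m : ZMod x.p) * conj (x.ψ (n : ZMod x.p))‖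
      ≤ (chrMod D p).card := by
    intro m n
    refine (norm_sum_le _ _).trans ?_
    have : ∀ x ∈ chrMod D p, ‖x.ψ (m : ZMod x.p) * conj (x.ψ (n : ZMod x.p))‖ ≤ 1 := fun x _ => by
      rw [norm_mul, Complex.norm_conj]
      exact mul_le_one₀ (x.ψ.norm_le_one _) (norm_nonneg _) (x.ψ.norm_le_one _)
    exact (Finset.sum_le_sum this).trans (by simp)
  have h := summable_sum_T_mul hL (t0 D) ha (nu χ) hS _ hX
  refine h.congr fun m => Finset.sum_congr rfl fun n hn => ?_
  rw [term_u005_eq c' χ p m (fun h => hS (h ▸ hn))]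

/-- **`Z22:§17.u005`, derivable reading, with the error explicit**: for every modulus `D ≥ 2` and
every `p`,
`‖Φ₃⁺(p) − Σ_mΣ_{1≤n≤D⁴} term_u005(p,m,n)‖ ≤ #chrMod(D,p)·(Σ_m|ν*(m)|m^{−3/2})·(Σ_{n≤D⁴}|ν(n)|√n)·e^{(1−𝓛₁²)/(4𝓛₂²)}`
("replacing the segment `𝔍(1)` by the line `σ = 3/2` and integrating term by term", per character,
then summed over `Σ*_{ψ (mod p)}`; the `n`-range is `n ≤ D⁴` = the range of `F(1−s,ψ̄)` in
`Skeleton.FpolyBar`, the print's "`n < D⁴`" being one term short).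
[cite: Zhang2022LandauSiegel, §17 p. 96 (before (17.3))] -/
theorem norm_Phi3plus_sub_tsum_le (hD : 2 ≤ D) (p : ℕ) :
    ‖Phi3plus c' χ p - ∑' m : ℕ, ∑ n ∈ Finset.Icc 1 (D ^ 4), term_u005 c' χ p m n‖
      ≤ (chrMod D p).card * (∑' m : ℕ, ‖LSeries.term (nuStar c' χ) (3 / 2 : ℂ) m‖) *
          (∑ n ∈ Finset.Icc 1 (D ^ 4), ‖nu χ n‖ * Real.sqrt n) *
          Real.exp ((1 - ell1 D ^ 2) / (4 * ell2 D ^ 2)) := by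
  have hL : 0 < ell2 D := pow_pos (Real.log_pos (by exact_mod_cast hD)) _
  have hS : (0 : ℕ) ∉ Finset.Icc 1 (D ^ 4) := by simp
  set S := Finset.Icc 1 (D ^ 4) with hS_def
  set A₀ : ℝ := ∑' m : ℕ, ‖LSeries.term (nuStar c' χ) (3 / 2 : ℂ) m‖ with hA₀
  set B₀ : ℝ := ∑ n ∈ S, ‖nu χ n‖ * Real.sqrt n with hB₀
  set E : ℝ := Real.exp ((1 - ell1 D ^ 2) / (4 * ell2 D ^ 2)) with hE
  -- per-character double sums
  set T : Chr D → ℕ → ℕ → ℂ := fun x m n =>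
    LSeries.term (fun m => nuStar c' χ m * psiFn x m) (SmoothWeight.s0 (t0 D)) m *
      ((nu χ n * conj (x.ψ (n : ZMod x.p))) * (n : ℂ) ^ (SmoothWeight.s0 (t0 D) - 1)) *
      cexp (-(ell2 D : ℂ) ^ 2 * (Real.log ((n : ℝ) / m) : ℂ) ^ 2) with hT
  have ha0 : LSeriesSummable (nuStar c' χ) (3 / 2 : ℂ) := LSeriesSummable_nuStar c' χ (by norm_num)
  have hsumx : ∀ x : Chr D, Summable fun m : ℕ => ∑ n ∈ S, T x m n := by
    intro x
    have hax : LSeriesSummable (fun m => nuStar c' χ m * psiFn x m) (3 / 2 : ℂ) :=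
      LSeriesSummable_nuStar_psi c' χ x (by norm_num)
    have h := summable_sum_T_mul hL (t0 D) hax (fun n => nu χ n * conj (x.ψ (n : ZMod x.p))) hS
      (fun _ _ => (1 : ℂ)) (K := 1) (fun _ _ => by simp)
    refine h.congr fun m => Finset.sum_congr rfl fun n _ => ?_
    simp only [hT, mul_one]
  -- (1) Φ₃⁺(p) − Σ_x (per-character double sum) is small
  have hper : ∀ x : Chr D, ‖Lemma81.segInt (t0 D) (ell1 D) 1 (fun s => kfrak3 c' χ x s * omegaW D s) -
      ∑' m : ℕ, ∑ n ∈ S, T x m n‖ ≤ A₀ * B₀ * E := by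
    intro x
    refine (norm_segInt_kfrak3_sub_tsum_le c' χ hD x).trans ?_
    have hA : (∑' m : ℕ, ‖LSeries.term (fun m => nuStar c' χ m * psiFn x m) (3 / 2 : ℂ) m‖) ≤ A₀ := by
      refine Summable.tsum_le_tsum (fun m => ?_) (summable_norm_iff.mpr
        (LSeriesSummable_nuStar_psi c' χ x (by norm_num))) (summable_norm_iff.mpr ha0)
      rw [LSeries.norm_term_eq, LSeries.norm_term_eq]
      split_ifs with hm
      · exact le_rfl
      · have : ‖nuStar c' χ m * psiFn x m‖ ≤ ‖nuStar c' χ m‖ := by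
          rw [norm_mul, psiFn]
          exact mul_le_of_le_one_right (norm_nonneg _) (x.ψ.norm_le_one _)
        exact div_le_div_of_nonneg_right this (by positivity)
    have hB : (∑ n ∈ S, ‖nu χ n * conj (x.ψ (n : ZMod x.p))‖ * Real.sqrt n) ≤ B₀ := by
      refine Finset.sum_le_sum fun n _ => ?_
      have : ‖nu χ n * conj (x.ψ (n : ZMod x.p))‖ ≤ ‖nu χ n‖ := by
        rw [norm_mul, Complex.norm_conj]
        exact mul_le_of_le_one_right (norm_nonneg _) (x.ψ.norm_le_one _)
      exact mul_le_mul_of_nonneg_right this (Real.sqrt_nonneg _)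
    have hA0 : 0 ≤ ∑' m : ℕ, ‖LSeries.term (fun m => nuStar c' χ m * psiFn x m) (3 / 2 : ℂ) m‖ :=
      tsum_nonneg fun _ => norm_nonneg _
    have hB0 : 0 ≤ ∑ n ∈ S, ‖nu χ n * conj (x.ψ (n : ZMod x.p))‖ * Real.sqrt n :=
      Finset.sum_nonneg fun _ _ => by positivity
    have hE0 : 0 ≤ E := (Real.exp_pos _).le
    gcongr
  -- (2) the sum over x of the per-character double sums is t6's double sum
  have hswap : ∑ x ∈ chrMod D p, ∑' m : ℕ, ∑ n ∈ S, T x m n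
      = ∑' m : ℕ, ∑ n ∈ S, term_u005 c' χ p m n := by
    rw [← Summable.tsum_finsetSum (fun x _ => hsumx x)]
    refine tsum_congr fun m => ?_
    rw [Finset.sum_comm]
    refine Finset.sum_congr rfl fun n hn => ?_
    exact sum_chrMod_T_eq_term_u005 c' χ p m (fun h => hS (h ▸ hn))
  -- assemble
  rw [Phi3plus, ← hswap, ← Finset.sum_sub_distrib]
  calc ‖∑ x ∈ chrMod D p, (Lemma81.segInt (t0 D) (ell1 D) 1 (fun s => kfrak3 c' χ x s * omegaW D s) -
          ∑' m : ℕ, ∑ n ∈ S, T x m n)‖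
      ≤ ∑ x ∈ chrMod D p, ‖Lemma81.segInt (t0 D) (ell1 D) 1 (fun s => kfrak3 c' χ x s * omegaW D s) -
          ∑' m : ℕ, ∑ n ∈ S, T x m n‖ := norm_sum_le _ _
    _ ≤ ∑ x ∈ chrMod D p, A₀ * B₀ * E := Finset.sum_le_sum fun x _ => hper x
    _ = (chrMod D p).card * A₀ * B₀ * E := by rw [Finset.sum_const, nsmul_eq_mul]; ring

/-! ## The diagonal, the count `#Σ*_{ψ (mod p)} = p − 2`, and the off-diagonal -/

omit [NeZero D] in
/-- **`#Σ*_{ψ (mod p)} = p − 2` for a window prime `p ∼ P`**: the members of `Ψ` of modulus `p` are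
the `p − 2` non-principal characters mod `p`. [cite: Zhang2022LandauSiegel, §2 p. 4; §17 p. 96] -/
theorem card_chrMod {p : ℕ} (hp : p ∈ primeWindow D) : (chrMod D p).card = p - 2 := by
  classical
  have hP : p.Prime := (Finset.mem_filter.mp hp).2
  haveI : Fact p.Prime := ⟨hP⟩
  haveI : NeZero p := ⟨hP.ne_zero⟩
  have h := Skeleton.sum_finsetOf_p_eq hp (fun _ _ => (1 : ℂ))
  rw [Finset.sum_const, Finset.sum_const, nsmul_eq_mul, nsmul_eq_mul, mul_one, mul_one,
    Finset.card_erase_of_mem (Finset.mem_univ _), Finset.card_univ] at h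
  have hcard : Fintype.card (DirichletCharacter ℂ p) = p - 1 := by
    rw [← Nat.card_eq_fintype_card, DirichletCharacter.card_eq_totient_of_hasEnoughRootsOfUnity ℂ p,
      Nat.totient_prime hP]
  rw [hcard] at h
  have : ((chrMod D p).card : ℂ) = ((p - 1 - 1 : ℕ) : ℂ) := by rw [chrMod]; exact h
  have h2 := hP.two_le
  rw [Nat.cast_inj] at this
  omega

omit [NeZero D] in
/-- **The diagonal term (ii)**: for `1 ≤ n < p`, `term_u005(p,n,n) = #chrMod(D,p)·ν*(n)ν(n)/n`
(`(n/n)^{s₀} = 1`, `e⁰ = 1`, `Σ_xψ_x(n)ψ̄_x(n) = Σ_x|ψ_x(n)|² = #chrMod` as `p ∤ n`).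
[cite: Zhang2022LandauSiegel, §17 (17.3) p. 96] -/
theorem term_u005_diag (p : ℕ) {n : ℕ} (hn1 : 1 ≤ n) (hnp : n < p) :
    term_u005 c' χ p n n = (chrMod D p).card * (nuStar c' χ n * nu χ n / (n : ℂ)) := by
  have hn0 : (n : ℝ) ≠ 0 := Nat.cast_ne_zero.mpr (by omega)
  have hX : ∑ x ∈ chrMod D p, x.ψ (n : ZMod x.p) * conj (x.ψ (n : ZMod x.p))
      = (chrMod D p).card := by
    rw [Finset.card_eq_sum_ones, Nat.cast_sum]
    refine Finset.sum_congr rfl fun x hx => ?_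
    have hx' : x ∈ ({x : Chr D | x.p = p} : Set (Chr D)) := mem_of_mem_finsetOf hx
    simp only [Set.mem_setOf_eq] at hx'
    have hnp' : n < x.p := hx' ▸ hnp
    have hu : IsUnit ((n : ZMod x.p)) := by
      rw [isUnit_iff_ne_zero, Ne, ZMod.natCast_eq_zero_iff]
      exact fun h => absurd (Nat.le_of_dvd (by omega) h) (not_le.mpr hnp')
    have h1 : ‖x.ψ (n : ZMod x.p)‖ = 1 := by
      have := x.ψ.unit_norm_eq_one hu.unit
      rwa [IsUnit.unit_spec] at this
    rw [Complex.mul_conj, Complex.normSq_eq_norm_sq, h1]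
    simp
  rw [term_u005, hX, div_self hn0, Real.log_one]
  push_cast
  rw [Complex.one_cpow]
  simp only [mul_zero, neg_zero, Complex.exp_zero, zero_pow two_ne_zero]
  ring

omit [NeZero D] in
/-- **"By trivial estimation, the contribution from the terms with `m ≠ n` is small"** — the
off-diagonal of t6's double sum, for a window prime `p` with `D⁴ < p`, `𝓛₂²·log(p/D⁴) ≥ 1` and any
`S ⊆ [1, D⁴]`: the `m`-series is summable and
`‖Σ_m Σ_{n∈S, n≠m} term_u005(p,m,n)‖ ≤ (Σ_m|ν*(m)|m^{−3/2})(Σ_{n∈S}|ν(n)|√n)(e^{1/(4𝓛₂²)} + (p−1)e^{−u₀(𝓛₂²u₀−1)})`,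
`u₀ = log(p/D⁴)` (`Zhang2022/SmoothWeightDiagonal.norm_offDiagonal_le` with `X₁ = 1`, `X₂ = p − 1`
from `PrimitiveCharOrthogonality`). [cite: Zhang2022LandauSiegel, §17 p. 96 ("By trivial estimation")] -/
theorem norm_offDiagonal_term_u005_le (hD : 2 ≤ D) {p : ℕ} (hp : p ∈ primeWindow D)
    (hDp : D ^ 4 < p) (hu₀ : 1 ≤ ell2 D ^ 2 * Real.log ((p : ℝ) / (D ^ 4 : ℕ)))
    {S : Finset ℕ} (hS : ∀ n ∈ S, n ≠ 0 ∧ n ≤ D ^ 4) :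
    Summable (fun m : ℕ => ∑ n ∈ S.filter (fun n => n ≠ m), term_u005 c' χ p m n) ∧
    ‖∑' m : ℕ, ∑ n ∈ S.filter (fun n => n ≠ m), term_u005 c' χ p m n‖
      ≤ (∑' m : ℕ, ‖LSeries.term (nuStar c' χ) (3 / 2 : ℂ) m‖) * (∑ n ∈ S, ‖nu χ n‖ * Real.sqrt n) *
          (1 * Real.exp (1 / (4 * ell2 D ^ 2)) +
            ((p : ℝ) - 1) * Real.exp (-(Real.log ((p : ℝ) / (D ^ 4 : ℕ)) *
              (ell2 D ^ 2 * Real.log ((p : ℝ) / (D ^ 4 : ℕ)) - 1)))) := by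
  have hL : 0 < ell2 D := pow_pos (Real.log_pos (by exact_mod_cast hD)) _
  have hP : p.Prime := (Finset.mem_filter.mp hp).2
  haveI : Fact p.Prime := ⟨hP⟩
  have ha : LSeriesSummable (nuStar c' χ) (3 / 2 : ℂ) := LSeriesSummable_nuStar c' χ (by norm_num)
  have hp1 : (1 : ℝ) ≤ p := by exact_mod_cast hP.one_le
  set X : ℕ → ℕ → ℂ := fun m n => ∑ x ∈ chrMod D p, x.ψ (m : ZMod x.p) * conj (x.ψ (n : ZMod x.p))
    with hX
  have hbd := fun m n => Skeleton.norm_sum_finsetOf_p_char_mul_conj_le hp m n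
  have hX1 : ∀ m n, n ∈ S → m ≠ n → m < p → ‖X m n‖ ≤ 1 := by
    intro m n hn hmn hmp
    have hnp : n < p := lt_of_le_of_lt (hS n hn).2 hDp
    refine (hbd m n).2 fun h => hmn ((PrimChar.natCast_eq_natCast_iff_of_lt hmp hnp).mp h)
  have hX2 : ∀ m n, n ∈ S → p ≤ m → ‖X m n‖ ≤ (p : ℝ) - 1 := fun m n _ _ => (hbd m n).1
  have key := SmoothWeight.norm_offDiagonal_le hL (t0 D) ha (nu χ) hS hDp hu₀ X zero_le_one
    (by linarith) hX1 hX2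
  have e : ∀ m, ∑ n ∈ S.filter (fun n => n ≠ m), term_u005 c' χ p m n
      = ∑ n ∈ S.filter (fun n => n ≠ m),
          LSeries.term (nuStar c' χ) (SmoothWeight.s0 (t0 D)) m *
            (nu χ n * (n : ℂ) ^ (SmoothWeight.s0 (t0 D) - 1)) *
            cexp (-(ell2 D : ℂ) ^ 2 * (Real.log ((n : ℝ) / m) : ℂ) ^ 2) * X m n := by
    intro m
    refine Finset.sum_congr rfl fun n hn => ?_
    exact term_u005_eq c' χ p m (hS n (Finset.mem_filter.mp hn).1).1
  simp_rw [e]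
  exact key

end Literature.NumberTheory.LFunctions.Zhang2022.Phi3TermByTerm
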